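import Summits.ResolutionOfSingularities.ResolutionOfSingularities.Theorems.FrobeniusClosingPatchingRelPerfectDepthPhaseCCarrierGameLiftAmbient
import HarnessLib

/-!
# Crux `PatchingRelPerfect` (stmt-ResolutionOfSingularities-16161), chain W5.2 — F7(β) (β-AX) X3 C-I finish (C0):
# THE CARRIER-LESS TWIN — on a patch where `K♭` IS a monomial sum in snc ambient letters, the marking-one game resolves it

[OURS · L1 W5.2 · res-L1-w52-plan-1 NAMING G12-16 / CONFIRM G12-17 → res-D-pv-046 (res-L1-w52-idea-1 ANSWER (M1) 19:22:25Z: on a fully-LMR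
pole patch C-I needs NO carrier — the letters are ambient divisors and the game «read ambiently» finishes); sibling of CE1 p561817]
Replaces the role of NO printed item; NOT a statement of the manuscript under review; fact-free; any dimension.

* `monomialPatchLift_of_pointedDistinct`, **`monomialPatchLift`** — `X₀` regular locally Noetherian, `𝓛` an snc letter list on `X₀`
  (pointed-distinct, resp. duplicate-free), `𝒦 ≠ []` exponent families on `𝓛`, `K = Σ_{A ∈ 𝒦} 𝓛^A` ⟹ a multiple blow-up of `X₀` with
  regular centres over `cosupp K`, regular top, `K𝒪_top` EFFECTIVE CARTIER. Proof = the marking-one dictionary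
  (`MonomialCleanup.exists_isAdmissibleFor_of_winnablePos_one`, CE1 part 2 p556791) on `X₀` ITSELF from the Route-K win
  (`PolyhedraGame.routeKTarget`), then the accumulated exceptional monomial (`CarrierGoingUp.exists_isEffectiveCartier_mul_transformMarked_ideal`,
  CE1 part 3 p560603) — no going-up.
* `MultiHostState.phaseCOne_conclusion_of_monomialPatch` / `…_of_local_monomialPatch` — plugged into res-L1-w52-lead-1's END GLUE
  p557185 (the presentation on all of `X`) / LOCAL END GLUE p557907 (the presentation on an open patch `X₀ ⊇ cosupp K♭`, `X` integral).

HONEST CAVEAT: the monomial presentation is a HYPOTHESIS here (the (M2a) LMR dictionary producing it is res-L1-w52-idea-1's Sketch v17, not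
this file). AI-written; AI review is weaker than expert review.

## References (for the mathematics; nothing here is a statement of the manuscript under review)
* J. Kollár, *Lectures on Resolution of Singularities* (2007), (3.111) Step 3, 3.72. [Kollar2007]
* E. Bierstone, D. Grigoriev, P. Milman, J. Włodarczyk, arXiv:1206.3090, Def. 3.1.3, Lemma 3.2.1. [BierstoneGrigorievMilmanWlodarczyk2011]
* M. Spivakovsky, *A solution to Hironaka's polyhedra game* (1983). [Spivakovsky1983]
-/

-- `Summit.<Summit>.<Sub>.Theorems` with `Sub = Summit` (single-conjunct summit, D-0017)
set_option linter.dupNamespace false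

noncomputable section

open CategoryTheory AlgebraicGeometry TopologicalSpace IsLocalRing
open Literature.AlgebraicGeometry.Resolution

namespace Summit.ResolutionOfSingularities.ResolutionOfSingularities.Theorems

namespace DepthMultiHost

open DepthTargets (monomialSum)
open MonomialCleanup (initialState initialState_wf gameInv_initialState_of_pointedDistinct
  exists_isAdmissibleFor_of_winnablePos_one PointedDistinct)
open PolyhedraGame (WinnablePos routeKTarget winnablePos_of_routeKTarget)

universe u

/-- [OURS · L1 W5.2] **(C0) THE CARRIER-LESS TWIN over pointed-distinct letters**: on a regular locally Noetherian `X₀`, a monomial sum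
`K = Σ_{A ∈ 𝒦} 𝓛^A` (`𝒦 ≠ []`) over an snc, pointed-distinct letter list `𝓛` is made an EFFECTIVE CARTIER divisor by a multiple blow-up with
regular centres over `cosupp K` and regular top (the marking-one polyhedra game read on `X₀` itself).
[cite: Kollar2007, (3.111) Step 3] [cite: BierstoneGrigorievMilmanWlodarczyk2011, Def. 3.1.3] [cite: Spivakovsky1983] -/
theorem monomialPatchLift_of_pointedDistinct {X₀ : Scheme.{u}} [IsLocallyNoetherian X₀] {K : X₀.IdealSheafData}
    (𝓛 : List X₀.IdealSheafData) (h𝓛 : HasSNC 𝓛) (h𝓛pd : PointedDistinct 𝓛)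
    (𝒦 : List (List (X₀.IdealSheafData × ℕ))) (hbd : ∀ A ∈ 𝒦, boundaryOf A = 𝓛) (h𝒦 : 𝒦 ≠ [])
    (hJ : K = monomialSum 𝒦) :
    ∃ t : CentreSeq X₀, t.AllRegular ∧ t.CentresOver (K.support : Set X₀) ∧ Scheme.IsRegular t.top ∧
      IsEffectiveCartier (K.comap t.comp) := by
  classical
  subst hJ
  have hw : WinnablePos 1 (initialState 𝓛.length 𝒦) :=
    winnablePos_of_routeKTarget (routeKTarget le_rfl) _ (initialState_wf 𝓛.length h𝒦) 𝓛.length rfl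
  obtain ⟨t, hadm, hreg, htop⟩ := exists_isAdmissibleFor_of_winnablePos_one hw X₀ 𝓛 𝒦 id
    (gameInv_initialState_of_pointedDistinct h𝓛 h𝓛pd hbd)
  obtain ⟨E, hE, hEq⟩ := CarrierGoingUp.exists_isEffectiveCartier_mul_transformMarked_ideal t ⟨monomialSum 𝒦, 𝓛, 1⟩ hadm
  refine ⟨t, CentreSeq.IsAdmissibleFor.allRegular _ _ hadm, CentreSeq.IsAdmissibleFor.centresOver _ _ hadm le_rfl, hreg, ?_⟩
  have hKE : (monomialSum 𝒦).comap t.comp = E := by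
    rw [htop, ← Scheme.IdealSheafData.one_eq_top, mul_one] at hEq
    exact hEq
  rw [hKE]
  exact hE

/-- [OURS · L1 W5.2] **(C0) THE CARRIER-LESS TWIN** (RULING G12-16, verbatim shape): on a regular locally Noetherian patch `X₀` where
`K = Σ_{A ∈ 𝒦} 𝓛^A` is ALREADY a monomial sum over a duplicate-free snc letter list `𝓛`, the marking-one game resolves it — regular
centres over `cosupp K`, regular top, `K𝒪_top` effective Cartier. (`hX₀` is implied by `HasSNC 𝓛` and kept for the interface of record.)
[cite: Kollar2007, (3.111) Step 3] [cite: BierstoneGrigorievMilmanWlodarczyk2011, Def. 3.1.3] [cite: Spivakovsky1983] -/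
theorem monomialPatchLift {X₀ : Scheme.{u}} [IsLocallyNoetherian X₀] (_hX₀ : Scheme.IsRegular X₀) {K : X₀.IdealSheafData}
    (𝓛 : List X₀.IdealSheafData) (h𝓛 : HasSNC 𝓛) (h𝓛nd : 𝓛.Nodup)
    (𝒦 : List (List (X₀.IdealSheafData × ℕ))) (hbd : ∀ A ∈ 𝒦, boundaryOf A = 𝓛) (h𝒦 : 𝒦 ≠ [])
    (hJ : K = monomialSum 𝒦) :
    ∃ t : CentreSeq X₀, t.AllRegular ∧ t.CentresOver (K.support : Set X₀) ∧ Scheme.IsRegular t.top ∧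
      IsEffectiveCartier (K.comap t.comp) :=
  monomialPatchLift_of_pointedDistinct 𝓛 h𝓛 (PointedDistinct.of_nodup h𝓛nd) 𝒦 hbd h𝒦 hJ

/-- [OURS · L1 W5.2] **(C0) ⇒ THE `PhaseCOne` CONCLUSION (presentation on all of `X`)**: for a state `S₁` with a summand on regular
Noetherian `X` whose residual `K♭` is a monomial sum over an snc pointed-distinct letter list — into res-L1-w52-lead-1's END GLUE
`phaseCOne_conclusion_of_isEffectiveCartier`. [cite: Kollar2007, (3.111) Step 3] -/
theorem MultiHostState.phaseCOne_conclusion_of_monomialPatch {X : Scheme.{u}} [IsNoetherian X]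
    (S₁ : MultiHostState X) (hn : S₁.n ≠ 0)
    (𝓛 : List X.IdealSheafData) (h𝓛 : HasSNC 𝓛) (h𝓛pd : PointedDistinct 𝓛)
    (𝒦 : List (List (X.IdealSheafData × ℕ))) (hbd : ∀ A ∈ 𝒦, boundaryOf A = 𝓛) (h𝒦 : 𝒦 ≠ [])
    (hJ : S₁.residual.K = monomialSum 𝒦) :
    ∃ (s : CentreSeq X), s.AllRegular ∧ s.CentresOver (S₁.K.support : Set X) ∧ Scheme.IsRegular s.top ∧
      ∃ (_ : IsNoetherian s.top) (M : s.top.IdealSheafData) (S₂ : MultiHostState s.top),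
        S₁.K.comap s.comp = M * S₂.K ∧ IsEffectiveCartier M ∧ S₂.n ≠ 0 ∧
        ∃ (U : s.top.Opens), S₂.residual.IsEndOn U := by
  obtain ⟨t, htreg, htover, httop, hE⟩ := monomialPatchLift_of_pointedDistinct 𝓛 h𝓛 h𝓛pd 𝒦 hbd h𝒦 hJ
  exact S₁.phaseCOne_conclusion_of_isEffectiveCartier hn t htreg htover httop hE

/-- [OURS · L1 W5.2] **(C0) ON A PATCH ⇒ THE `PhaseCOne` CONCLUSION**: `X` regular Noetherian integral, `S₁` a state with a summand and
non-zero residual `K♭`, `j : X₀ ⟶ X` an open immersion with `cosupp K♭ ⊆ j(X₀)` on which `K♭|_{X₀}` is a monomial sum over an snc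
pointed-distinct letter list of `X₀` — into res-L1-w52-lead-1's LOCAL END GLUE `phaseCOne_conclusion_of_local`.
[cite: Kollar2007, (3.111) Step 3] [cite: GortzWedhorn2020, Prop. 13.91 (1)–(2)] -/
theorem MultiHostState.phaseCOne_conclusion_of_local_monomialPatch {X X₀ : Scheme.{u}} [IsNoetherian X] [IsIntegral X]
    (hX : Scheme.IsRegular X) (S₁ : MultiHostState X) (hn : S₁.n ≠ 0) (hK0 : S₁.residual.K ≠ ⊥)
    (j : X₀ ⟶ X) [IsOpenImmersion j] (hZj : (S₁.residual.K.support : Set X) ⊆ Set.range j.base)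
    (𝓛 : List X₀.IdealSheafData) (h𝓛 : HasSNC 𝓛) (h𝓛pd : PointedDistinct 𝓛)
    (𝒦 : List (List (X₀.IdealSheafData × ℕ))) (hbd : ∀ A ∈ 𝒦, boundaryOf A = 𝓛) (h𝒦 : 𝒦 ≠ [])
    (hJ : S₁.residual.K.comap j = monomialSum 𝒦) :
    ∃ (s : CentreSeq X), s.AllRegular ∧ s.CentresOver (S₁.K.support : Set X) ∧ Scheme.IsRegular s.top ∧
      ∃ (_ : IsNoetherian s.top) (M : s.top.IdealSheafData) (S₂ : MultiHostState s.top),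
        S₁.K.comap s.comp = M * S₂.K ∧ IsEffectiveCartier M ∧ S₂.n ≠ 0 ∧
        ∃ (U : s.top.Opens), S₂.residual.IsEndOn U := by
  haveI : IsLocallyNoetherian X₀ := LocallyOfFiniteType.isLocallyNoetherian j
  obtain ⟨t₀, h₀reg, h₀over, -, hE⟩ := monomialPatchLift_of_pointedDistinct 𝓛 h𝓛 h𝓛pd 𝒦 hbd h𝒦 hJ
  refine S₁.phaseCOne_conclusion_of_local hX hn hK0 j hZj t₀ h₀reg ?_ hE.isLocallyPrincipal
  rw [Scheme.IdealSheafData.support_comap] at h₀over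
  exact h₀over

end DepthMultiHost

end Summit.ResolutionOfSingularities.ResolutionOfSingularities.Theorems

end
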